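import Literature.MathematicalPhysics.QuantumFieldTheory.Balaban1983to89.B7Eq84ConcreteRec
import Literature.MathematicalPhysics.QuantumFieldTheory.Balaban1983to89.B8Ineq130Rec
import Literature.MathematicalPhysics.QuantumFieldTheory.Balaban1983to89.B8Ineq172Concrete

/-!
# `Balaban1983to89.B8Ineq172ConcreteRec` — RECORD TWIN of `B8Ineq172Concrete` §1 ([Balaban1985RegularSpaces] proof of Theorem 4, pp. 88–89: LOCALITY of the gauge
# fixing (104)–(106), of the frames (85), of the averages (79)–(80) and of the (167)-expression of [3] ON THE BLOCK TOWER under a level-`j` site) for the SYMMETRISED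
# CENTRED block averaging (0.4) of [Balaban1987RG1] — dag-n05-d's CENTRED towers

statement-level skeleton of published theorems with citation tags; proofs where landed; nothing here is a claim about the Yang–Mills mass gap

T. Bałaban, *Spaces of regular gauge field configurations on a lattice and gauge fixing conditions*, Commun. Math. Phys. **99** (1985) 75–102
`[Balaban1985RegularSpaces]` ("[6]"): (1.70)–(1.74) pp. 88–89; T. Bałaban, *Averaging operations for lattice gauge theories*, Commun. Math. Phys. **98** (1985) 17–51
`[Balaban1985Averaging]` ("[3]"): p. 24 (locality of (43)), (58) p. 27, (65)∕(69) p. 29, (76)–(80) pp. 29–30, (85)–(87) p. 31, (104)–(106) p. 33, (167) p. 44; T. Bałaban,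
*Renormalization group approach to lattice gauge field theories. I*, Commun. Math. Phys. **109** (1987) 249–301 `[Balaban1987RG1]` ("[I]"): (0.3)–(0.4) pp. 252–253,
pp. 253–254.  STATUS: published, refereed.

CITATION HEADER (lean-in-tree rule).  Cell `pub-ymgap`, base `pub-ymgap-dag-n05-c` g26 — N05-REC stage 2 (director-ym №254∕№255∕№265), item R5, LEAD PEN dag-n05-e
(inventory `N05-REC-INVENTORY.md` e50db04501ab292d §R5 row `B8Ineq172Concrete`: A `wrec_congr_tower tHol_block_congr hol_block_congr avgIter_agree_tower tildIter_agree_tower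
uavg_congr_tower glev_congr_tower`).  WHAT IS REPRODUCED = ✓`B8Ineq172Concrete` §1 under the cell's TOKEN RULE over dag-n05-d's `B8Ineq130Rec` (CENTRED towers
`tlo ∕ thi`, odd `L = 2s+1`: `agree_level`, `block_mem`, `smul_mem`, `fl_mem`), dag-n05-e's R0b∕R1 twins (`avgIterZ`, `tildIterZ(_apply)`, `wrecZ(_zero,_succ)`, `uavgZ`,
`glevZ(_top,_of_lt)`, `flZ ∕ bremZ ∕ flZ_decomp`, `savgZ_congr`); the engine's generic `hol_treeWord_congr ∕ tHol_treeWord_congr ∕ agreeOn_mul ∕ inBox_of_le` are REUSED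
BY NAME.  One bridging remark `flZ_eq_fl` (dag-n05-e's `flZ` and dag-n05-d's `B8Ineq130Rec.fl` are the same map, by `rfl`).  Proofs = the engine proofs line by line.  Kind
«kernel-checked proof», theorems only; no `def`, no `instance`, no `notation`, no existing module modified.  `--supports stmt-QuantumFields-20541` (K0⁷-keyed, COUNT-NEUTRAL).

HONEST SCOPE: locality bookkeeping; NO inequality of [3]∕[6]∕[I]; the engine's §2–§4 ((1.72)–(1.74) with LOCAL hypotheses, over [3] Props 8–10 ∕ (166)–(177)) are NOT twinned here
(road item R1's twins first); `HThm4Rec` UNDISCHARGED; caveat (C-S3-1) stands with №265's addendum («hybrid record — linearised average of record = print's (128) average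
composed with a covariant coarse gauge shift Λ_j carried as a letter and absorbed into u at the Theorem-4 socket; flat-letter layer off the path modulo N2a–c»); N05 [B8]
DISCHARGED OF RECORD untouched; COUNT of record unmoved by this · K 1∕4; one finite `𝕋⁴` programme at fixed `ε`, Bałaban AS PRINTED; nothing continuum ∕ ℝ⁴ ∕ OS ∕ mass-gap ∕
Clay.  No `sorry`, no `def`.

[cite: Balaban1985RegularSpaces, (1.70)–(1.74) pp.88–89; Balaban1985Averaging, p.24, (58) p.27, (65) p.29, (76)–(80) pp.29–30, (85)–(87) p.31, (104)–(106) p.33, (167) p.44; Balaban1987RG1, (0.3)–(0.4) pp.252–253]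
-/

noncomputable section

open NormedSpace Finset

namespace Literature.MathematicalPhysics.QuantumFieldTheory.Balaban1983to89.B8Ineq172ConcreteRec

open B7Prop1Explicit B7Prop2Explicit B7Prop3Flat B7Prop1Local B7Eq92Concrete B7Eq99Concrete
open B7LocalityGeneral (agreeOn_mul tHol_treeWord_congr)
open B8Ineq130 (inBox_of_le)
open BlockAveragingZd (offZ avgIterZ)
open B7SectCDGaugeAveragesRec (flZ bremZ flZ_decomp tildIterZ tildIterZ_apply wrecZ wrecZ_zero uavgZ uavgZ_zero uavgZ_succ glevZ savgZ R0avgZ)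
open B7Eq99ConcreteRec (wrecZ_succ)
open B7Eq84ConcreteRec (savgZ_congr glevZ_of_lt glevZ_top)
open B8Ineq130Rec (tlo thi tlo_zero thi_zero agree_level block_mem smul_mem fl_mem)

-- `Site` alone could resolve to the torus sites of `Setup.lean`; re-export the `ℤ^d` sites of `B7Prop1Explicit`.
export B7Prop1Explicit (Site)

variable {d : ℕ}

/-! ## §1 Locality of the gauge fixing (104)–(106) of [3] on the CENTRED block tower under a level-`j` site `y` -/

section Congr

variable {𝔸 : Type*} [NormedRing 𝔸] [NormedAlgebra ℂ 𝔸] [CompleteSpace 𝔸]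
variable {L s : ℕ} {y : Site d} {j : ℕ} {U₀ U₀' U₁ U₁' : Site d → Fin d → 𝔸ˣ}

omit [NormedAlgebra ℂ 𝔸] [CompleteSpace 𝔸] in
/-- The two spellings of the centred block map agree: dag-n05-e's `flZ L x = fl L (x + ctrVec L)` IS dag-n05-d's `B8Ineq130Rec.fl L x = fl L (x + halfVec L)`
(`ctrVec = halfVec = (L−1)∕2·𝟙`, by `rfl`). [cite: Balaban1987RG1, (0.3) p.252 (bookkeeping)] -/
theorem flZ_eq_fl (L : ℕ) (x : Site d) : flZ L x = B8Ineq130Rec.fl L x := rfl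

/-- **Locality of the record averaged backgrounds on the centred tower** (twin of `avgIter_agree_tower`; [3] p. 24): if `U₀`, `U₀′` agree on the bonds of the fine
block `Bʲ(y)`, then `Ū₀ᵐ` and `Ū₀′ᵐ` agree on the bonds of the block `Bⁿ(y)` of the level-`m` lattice, `n + m = j` (`B8Ineq130Rec.agree_level`; odd `L = 2s+1`).
[cite: Balaban1985Averaging, p.24 (sentence after (43)); Balaban1987RG1, (0.3) p.252] -/
theorem avgIterZ_agree_tower (hL : L = 2 * s + 1) (h₀ : AgreeOn (tlo L y j) (thi L y j) U₀ U₀') {m n : ℕ} (hmn : n + m = j) :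
    AgreeOn (tlo L y n) (thi L y n) (avgIterZ L U₀ m) (avgIterZ L U₀' m) :=
  agree_level hL m n (by rw [hmn]; exact h₀)

/-- **Locality of the record relative averages `Ũ₁ᵐ`** ((65)∕(69), twin of `tildIter_agree_tower`) on the centred tower. [cite: Balaban1985Averaging, (65) p.29, (69) p.29, p.24] -/
theorem tildIterZ_agree_tower (hL : L = 2 * s + 1) (h₀ : AgreeOn (tlo L y j) (thi L y j) U₀ U₀')
    (h₁ : AgreeOn (tlo L y j) (thi L y j) U₁ U₁') {m n : ℕ} (hmn : n + m = j) :
    AgreeOn (tlo L y n) (thi L y n) (tildIterZ L U₀ U₁ m) (tildIterZ L U₀' U₁' m) := by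
  intro q κ hq hqκ
  rw [tildIterZ_apply, tildIterZ_apply, avgIterZ_agree_tower hL (agreeOn_mul h₁ h₀) hmn q κ hq hqκ,
    avgIterZ_agree_tower hL h₀ hmn q κ hq hqκ]

/-- The transport of the record averaged background `Ū₀ᵐ(Γ_{x_{m+1},x_m})` along a (1.7) staircase from the CENTRE `x_{m+1} = Lz` to a block point `x_m = Lz + offZ r` is the
same for `U₀` and `U₀′` agreeing on the tower (twin of `hol_block_congr`). [cite: Balaban1985Averaging, p.24, (58) p.27; Balaban1987RG1, (0.3) p.252] -/
theorem hol_block_congr (hL : L = 2 * s + 1) (h₀ : AgreeOn (tlo L y j) (thi L y j) U₀ U₀') {m n : ℕ} (hmn : n + (m + 1) = j)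
    {z : Site d} (hz : tlo L y n ≤ z) (hz' : z ≤ thi L y n) (r : Fin d → Fin L) :
    hol (avgIterZ L U₀ m) ((L : ℤ) • z) (treeWord (offZ L r))
      = hol (avgIterZ L U₀' m) ((L : ℤ) • z) (treeWord (offZ L r)) := by
  obtain ⟨h1, h2⟩ := smul_mem hz hz'
  obtain ⟨h3, h4⟩ := block_mem hL hz hz' r
  exact hol_treeWord_congr (avgIterZ_agree_tower hL h₀ (show (n + 1) + m = j by omega)) _ _ (inBox_of_le h1 h2)
    (inBox_of_le h3 h4)

/-- The twisted transport `(R̄ᵐ_{0,x_{m+1}}Ũ₁ᵐ)(Γ_{x_{m+1},x_m})` ((58)∕(76)) along a centre-rooted staircase of the tower is the same for `(U₀, U₁)` and `(U₀′, U₁′)`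
(twin of `tHol_block_congr`). [cite: Balaban1985Averaging, (58) p.27, (76) p.29, p.24] -/
theorem tHol_block_congr (hL : L = 2 * s + 1) (h₀ : AgreeOn (tlo L y j) (thi L y j) U₀ U₀')
    (h₁ : AgreeOn (tlo L y j) (thi L y j) U₁ U₁') {m n : ℕ} (hmn : n + (m + 1) = j)
    {z : Site d} (hz : tlo L y n ≤ z) (hz' : z ≤ thi L y n) (r : Fin d → Fin L) :
    tHol (avgIterZ L U₀ m) (tildIterZ L U₀ U₁ m) ((L : ℤ) • z) (treeWord (offZ L r))
      = tHol (avgIterZ L U₀' m) (tildIterZ L U₀' U₁' m) ((L : ℤ) • z) (treeWord (offZ L r)) := by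
  obtain ⟨h1, h2⟩ := smul_mem hz hz'
  obtain ⟨h3, h4⟩ := block_mem hL hz hz' r
  have hmn' : (n + 1) + m = j := by omega
  exact tHol_treeWord_congr (avgIterZ_agree_tower hL h₀ hmn') (tildIterZ_agree_tower hL h₀ h₁ hmn') _ _
    (inBox_of_le h1 h2) (inBox_of_le h3 h4)

/-- **Locality of the record block frames (85)** `w_m(x_m) = \overline{R_{0,x_m}U₁}^{(m)}` on the centred tower (twin of `wrec_congr_tower`): `wrecZ L U₀ U₁ m z = wrecZ L U₀′ U₁′ m z`
at every level-`m` site `z` of `Bⁿ(y)`, `n + m = j` (induction on `m` through (78)∕(85)). [cite: Balaban1985Averaging, (85) p.31, (78) p.30, p.24] -/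
theorem wrecZ_congr_tower (hL : L = 2 * s + 1) (h₀ : AgreeOn (tlo L y j) (thi L y j) U₀ U₀')
    (h₁ : AgreeOn (tlo L y j) (thi L y j) U₁ U₁') :
    ∀ (m n : ℕ), n + m = j → ∀ z : Site d, tlo L y n ≤ z → z ≤ thi L y n →
      wrecZ L U₀ U₁ m z = wrecZ L U₀' U₁' m z
  | 0, n, _, z, _, _ => by rw [wrecZ_zero, wrecZ_zero]
  | m + 1, n, hmn, z, hz, hz' => by
    rw [wrecZ_succ, wrecZ_succ]
    obtain ⟨h1, h2⟩ := smul_mem hz hz'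
    refine savgZ_congr L ?_ fun r => ?_
    · simp only [sub_self, treeWord_zero, tHol_nil, one_mul, R0fun_self]
      exact wrecZ_congr_tower hL h₀ h₁ m (n + 1) (by omega) _ h1 h2
    · obtain ⟨h3, h4⟩ := block_mem hL hz hz' r
      simp only [add_sub_cancel_left, R0fun_apply]
      rw [tHol_block_congr hL h₀ h₁ hmn hz hz' r, hol_block_congr hL h₀ hmn hz hz' r,
        wrecZ_congr_tower hL h₀ h₁ m (n + 1) (by omega) _ h3 h4]

/-- **LOCALITY OF THE RECORD GAUGE FIXING (104)–(106) OF [3]** (twin of `glev_congr_tower`): the level functions `glevZ … j m` of the gauge transformation determined by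
`(U₀, U₁)` at top level `j` ((87) at level `j`, then (76) block by block downwards through the CENTRED block map `flZ ∕ bremZ`) coincide on the tower under `y` for two pairs
agreeing on the bonds of `Bʲ(y)`: at every depth `n ≤ j` and every level-`(j−n)` site `x` of `Bⁿ(y)`. [cite: Balaban1985Averaging, (106) p.33, (76)–(77) p.29–30, (87) p.31; Balaban1985RegularSpaces, (1.70) p.88] -/
theorem glevZ_congr_tower (hL : L = 2 * s + 1) (hL1 : 1 ≤ L) (h₀ : AgreeOn (tlo L y j) (thi L y j) U₀ U₀')
    (h₁ : AgreeOn (tlo L y j) (thi L y j) U₁ U₁') :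
    ∀ (n m : ℕ), n + m = j → ∀ x : Site d, tlo L y n ≤ x → x ≤ thi L y n →
      glevZ L hL1 U₀ U₁ j m x = glevZ L hL1 U₀' U₁' j m x
  | 0, m, hm, x, hx, hx' => by
    have hmj : m = j := by omega
    subst hmj
    rw [tlo_zero] at hx
    rw [thi_zero] at hx'
    rw [glevZ_top, glevZ_top, wrecZ_congr_tower hL h₀ h₁ m 0 (by omega) x (by simpa using hx) (by simpa using hx')]
  | n + 1, m, hm, x, hx, hx' => by
    have hmj : m < j := by omega
    obtain ⟨hf, hf'⟩ := fl_mem hL hx hx'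
    rw [← flZ_eq_fl] at hf hf'
    rw [glevZ_of_lt L hL1 U₀ U₁ hmj, glevZ_of_lt L hL1 U₀' U₁' hmj]
    rw [hol_block_congr hL h₀ (show n + (m + 1) = j by omega) hf hf',
      tHol_block_congr hL h₀ h₁ (show n + (m + 1) = j by omega) hf hf',
      glevZ_congr_tower hL hL1 h₀ h₁ n (m + 1) (by omega) _ hf hf']

/-- **Locality of the record averages `\overline{R₀u}ᵐ` (79)∕(80)** on the centred tower (twin of `uavg_congr_tower`): for gauge transformations `u`, `u′` equal on the fine
sites of `Bʲ(y)` and backgrounds agreeing on its bonds, `uavgZ L U₀ u m z = uavgZ L U₀′ u′ m z` at every level-`m` site `z` of `Bⁿ(y)`, `n + m = j`.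
[cite: Balaban1985Averaging, (78)–(80) p.30, p.24] -/
theorem uavgZ_congr_tower (hL : L = 2 * s + 1) (h₀ : AgreeOn (tlo L y j) (thi L y j) U₀ U₀') {u u' : Site d → 𝔸ˣ}
    (hu : ∀ x : Site d, tlo L y j ≤ x → x ≤ thi L y j → u x = u' x) :
    ∀ (m n : ℕ), n + m = j → ∀ z : Site d, tlo L y n ≤ z → z ≤ thi L y n →
      uavgZ L U₀ u m z = uavgZ L U₀' u' m z
  | 0, n, hn, z, hz, hz' => by
    have hnj : n = j := by omega
    subst hnj
    rw [uavgZ_zero, uavgZ_zero, hu z hz hz']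
  | m + 1, n, hmn, z, hz, hz' => by
    rw [uavgZ_succ, uavgZ_succ, R0avgZ, R0avgZ]
    obtain ⟨h1, h2⟩ := smul_mem hz hz'
    refine savgZ_congr L ?_ fun r => ?_
    · rw [R0fun_self, R0fun_self]
      exact uavgZ_congr_tower hL h₀ hu m (n + 1) (by omega) _ h1 h2
    · obtain ⟨h3, h4⟩ := block_mem hL hz hz' r
      simp only [R0fun_apply, add_sub_cancel_left]
      rw [hol_block_congr hL h₀ hmn hz hz' r, uavgZ_congr_tower hL h₀ hu m (n + 1) (by omega) _ h3 h4]

/-- **Locality of the (167)-expression** `(\overline{R₀u}ᵐ)⁻¹(x_{m+1})(R̄ᵐ_{0,x_{m+1}}\overline{R₀u}ᵐ)(x_m)`, record structure (twin of `expr167_congr_tower`), on the centred tower.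
[cite: Balaban1985Averaging, (167) p.44; Balaban1985RegularSpaces, (1.74) p.89] -/
theorem expr167Z_congr_tower (hL : L = 2 * s + 1) (h₀ : AgreeOn (tlo L y j) (thi L y j) U₀ U₀') {u u' : Site d → 𝔸ˣ}
    (hu : ∀ x : Site d, tlo L y j ≤ x → x ≤ thi L y j → u x = u' x) {m n : ℕ} (hmn : n + (m + 1) = j)
    {z : Site d} (hz : tlo L y n ≤ z) (hz' : z ≤ thi L y n) (r : Fin d → Fin L) :
    (uavgZ L U₀ u m ((L : ℤ) • z))⁻¹
        * Rc (hol (avgIterZ L U₀ m) ((L : ℤ) • z) (treeWord (offZ L r))) (uavgZ L U₀ u m ((L : ℤ) • z + offZ L r))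
      = (uavgZ L U₀' u' m ((L : ℤ) • z))⁻¹
        * Rc (hol (avgIterZ L U₀' m) ((L : ℤ) • z) (treeWord (offZ L r)))
            (uavgZ L U₀' u' m ((L : ℤ) • z + offZ L r)) := by
  obtain ⟨h1, h2⟩ := smul_mem hz hz'
  obtain ⟨h3, h4⟩ := block_mem hL hz hz' r
  rw [hol_block_congr hL h₀ hmn hz hz' r, uavgZ_congr_tower hL h₀ hu m (n + 1) (by omega) _ h1 h2,
    uavgZ_congr_tower hL h₀ hu m (n + 1) (by omega) _ h3 h4]

end Congr

end Literature.MathematicalPhysics.QuantumFieldTheory.Balaban1983to89.B8Ineq172ConcreteRec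

end
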